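import Summits.BirchSwinnertonDyer.BirchSwinnertonDyer.Theorems.ManinLocalTwoThreeShiftInvariantIsDiamondAssembly
import Summits.BirchSwinnertonDyer.BirchSwinnertonDyer.Theorems.ManinLocalTwoThreeHeckeWordAnnihilator
import Summits.BirchSwinnertonDyer.BirchSwinnertonDyer.Theorems.ManinLocalTwoThreeBoundaryEisenstein
import Summits.BirchSwinnertonDyer.BirchSwinnertonDyer.Theorems.ManinLocalTwoThreeBoundaryHeckeCommute
import HarnessLib

/-!
# (BND) DISCHARGED: the boundary annihilator word from p2's E-es-30 `boundaryEisenstein` — hence the leaf E-es-25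
# `RelativeIharaShiftVanishingBar p t n` from PARABOLICITY alone

Summit `BirchSwinnertonDyer`, route `ManinLocalTwoThree` (cell bsd-f2-manin), cruxes C2 `ManinOddAtFour`
(stmt-BirchSwinnertonDyer-22967) / C3 `ManinPrimeToThreeAtNine` (stmt-BirchSwinnertonDyer-22968); registered stubs
`stub_relativeIharaBarTwo : ∀ t n, RelativeIharaShiftVanishingBar 2 t n` / `stub_relativeIharaBar331 : RelativeIharaShiftVanishingBar 3 3 1`.
`Theorems/ManinLocalTwoThreeShiftInvariantIsDiamondAssembly.lean` (p3) proves the leaf from (PAR) ∧ (BND).  Here (BND) is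
PROVED from p2's E-es-30 `boundaryEisenstein` (`Theorems/ManinLocalTwoThreeBoundaryEisenstein.lean`: over an algebraically
closed field every joint generalised eigen-system of the `T_r` on the boundary symbols of `Γ₀(M)` is Eisenstein) and the
abstract annihilator (`Theorems/ManinLocalTwoThreeHeckeWordAnnihilator.lean`, p3):

* §1 base change of symbols along `ι : K → K̄ = AlgebraicClosure K`: boundary-ness, the Hecke operators and generalised
  eigenspaces are compatible with `Ψ ↦ ι ∘ Ψ`, which is injective;
* §2 `boundary_gen_eigen_eq_zero_finset` — E-es-30 transported to `K` and to FINITELY many primes: there is a finite set `F`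
  of primes `∉ S` such that a boundary symbol of level `M` over `K` lying in `maxGenEigenspace (symbolHecke M r K) (λ r)` for
  all `r ∈ F` vanishes (p2's `boundaryEisenstein` over `K̄`, p3's `exists_finset_forall_mem_imp_eq_zero`, injectivity);
* §3 **`boundaryKilled_of_prime`** — (BND) in the exact shape consumed by the assembly: for `λ̄` non-Eisenstein and any
  exponents `k`, a word `(rᵢ, qᵢ)`, `rᵢ ∉ S`, `rᵢ ∤ tⁿ`, `rᵢ ∤ L tⁿ`, `qᵢ ≡ 1 mod (X − λ(rᵢ))^{k rᵢ}`, with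
  `F.foldr (aeval (symbolHecke L r K) q) Ψ = 0` for every boundary `Ψ` of level `L tⁿ` (annihilator over `K`; the `T_r` commute
  on boundary symbols by p2's `symbolHecke_comm_of_mem`; index level moved from `L tⁿ` to `L` by `symbolHecke_eq_of_not_dvd`);
* §4 **`relativeIharaShiftVanishingBar_of_parabolic (hPAR) : RelativeIharaShiftVanishingBar p t n`** — THE LEAF FROM
  PARABOLICITY ALONE (the `∂`-side twin of E-es-30, being landed by p2/p1 as `parabolic_of_isHeckeGenEigenvector…`).

Nothing about BSD or Manin's conjecture is proved here.  References: HOME/MEMO-es.md §22.3, §23 (cell bsd-f2-manin).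
-/

set_option autoImplicit false
set_option linter.dupNamespace false

open scoped MatrixGroups Polynomial

open CongruenceSubgroup Matrix.SpecialLinearGroup Polynomial Literature.NumberTheory.EllipticCurves.ModularForms
  Literature.NumberTheory.EllipticCurves.ModularForms.HidaCohomology
  Summit.BirchSwinnertonDyer.Rank1Residual.ManinAdditive

namespace Summit.BirchSwinnertonDyer.BirchSwinnertonDyer.Theorems.ManinLocalTwoThree

noncomputable section

/-! ### §1  Base change of symbols along a ring map -/

section BaseChange

variable {K K' : Type*} [Field K] [Field K'] (ι : K →+* K') (M : ℕ) {r : ℕ} [NeZero r]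

/-- `T_r` commutes with base change of the values. [folklore] -/
theorem symbolHecke_baseChange (Ψ : OnePoint ℚ → OnePoint ℚ → K) :
    symbolHecke M r K' (fun a b => ι (Ψ a b)) = fun a b => ι (symbolHecke M r K Ψ a b) := by
  funext a b
  rw [symbolHecke_apply, symbolHecke_apply, map_sum]

/-- Powers of `T_r − μ` commute with base change of the values. [folklore] -/
theorem pow_sub_baseChange (μ : K) (m : ℕ) (Ψ : OnePoint ℚ → OnePoint ℚ → K) :
    ((symbolHecke M r K' - ι μ • (1 : Module.End K' (OnePoint ℚ → OnePoint ℚ → K'))) ^ m) (fun a b => ι (Ψ a b)) =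
      fun a b => ι (((symbolHecke M r K - μ • (1 : Module.End K (OnePoint ℚ → OnePoint ℚ → K))) ^ m) Ψ a b) := by
  induction m generalizing Ψ with
  | zero => rfl
  | succ m ih =>
    rw [pow_succ, Module.End.mul_apply, pow_succ, Module.End.mul_apply]
    have e : (symbolHecke M r K' - ι μ • (1 : Module.End K' (OnePoint ℚ → OnePoint ℚ → K'))) (fun a b => ι (Ψ a b)) =
        fun a b => ι ((symbolHecke M r K - μ • (1 : Module.End K (OnePoint ℚ → OnePoint ℚ → K))) Ψ a b) := by
      rw [LinearMap.sub_apply, LinearMap.smul_apply, Module.End.one_apply, symbolHecke_baseChange]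
      funext a b
      simp only [Pi.sub_apply, Pi.smul_apply, smul_eq_mul, LinearMap.sub_apply, LinearMap.smul_apply,
        Module.End.one_apply, map_sub, map_mul]
    rw [e, ih]

/-- Generalised eigenvectors base-change to generalised eigenvectors. [folklore] -/
theorem mem_maxGenEigenspace_baseChange {μ : K} {Ψ : OnePoint ℚ → OnePoint ℚ → K}
    (h : Ψ ∈ Module.End.maxGenEigenspace (symbolHecke M r K) μ) :
    (fun a b => ι (Ψ a b)) ∈ Module.End.maxGenEigenspace (symbolHecke M r K') (ι μ) := by
  rw [Module.End.mem_maxGenEigenspace] at h ⊢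
  obtain ⟨m, hm⟩ := h
  refine ⟨m, ?_⟩
  rw [pow_sub_baseChange ι M μ m Ψ, hm]
  funext a b
  exact map_zero ι

omit [NeZero r] in
/-- Boundary symbols base-change to boundary symbols. [folklore] -/
theorem mem_boundary_baseChange {Ψ : OnePoint ℚ → OnePoint ℚ → K} (h : Ψ ∈ (cuspInvariants M K).map (boundaryOf K)) :
    (fun a b => ι (Ψ a b)) ∈ (cuspInvariants M K').map (boundaryOf K') := by
  obtain ⟨w, hw, rfl⟩ := Submodule.mem_map.mp h
  refine Submodule.mem_map.mpr ⟨fun x => ι (w x), ?_, ?_⟩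
  · rw [mem_cuspInvariants] at hw ⊢
    intro γ x
    rw [hw γ x]
  · funext a b
    simp only [boundaryOf_apply, map_sub]

omit [NeZero r] in
/-- Base change of the values is injective on symbols. [folklore] -/
theorem eq_zero_of_baseChange_eq_zero {Ψ : OnePoint ℚ → OnePoint ℚ → K} (h : (fun a b => ι (Ψ a b)) = 0) : Ψ = 0 := by
  funext a b
  have := congrFun (congrFun h a) b
  exact ι.injective (by simpa using this)

end BaseChange

/-! ### §2  E-es-30 over `K`, at finitely many primes -/

section Finite

variable (M : ℕ) [NeZero M] {K : Type*} [Field K]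

/-- **E-es-30 transported**: for `S ⊇` primes of `M` and `λ` with `λ̄` NOT Eisenstein over `K̄`, there is a FINITE set `F` of
primes outside `S` such that every boundary symbol of level `M` over `K` lying in `maxGenEigenspace (symbolHecke M r K) (λ r)`
for all `r ∈ F` is `0`.  (p2's `boundaryEisenstein` over `K̄ = AlgebraicClosure K`, finiteness by
`exists_finset_forall_mem_imp_eq_zero` in the finite-dimensional `K̄`-module of boundary symbols, base change §1.) [folklore] -/
theorem boundary_gen_eigen_eq_zero_finset (S : Finset ℕ) (hS : ∀ q : ℕ, q.Prime → q ∣ M → q ∈ S) (lam : ℕ → K)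
    (hne : ¬ IsEisensteinEigensystem 2 (fun ℓ => algebraMap K (AlgebraicClosure K) (lam ℓ))) :
    ∃ F : Finset {r : ℕ // r.Prime ∧ r ∉ S}, ∀ Ψ : OnePoint ℚ → OnePoint ℚ → K,
      Ψ ∈ (cuspInvariants M K).map (boundaryOf K) →
      (∀ i ∈ F, Ψ ∈ Module.End.maxGenEigenspace (@symbolHecke M i.1 ⟨i.2.1.ne_zero⟩ K _) (lam i.1)) → Ψ = 0 := by
  classical
  let Kb := AlgebraicClosure K
  let ι : K →+* Kb := algebraMap K Kb
  let idx := {r : ℕ // r.Prime ∧ r ∉ S}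
  let Tb : idx → Module.End Kb (OnePoint ℚ → OnePoint ℚ → Kb) := fun i => @symbolHecke M i.1 ⟨i.2.1.ne_zero⟩ Kb _
  -- E-es-30 over `K̄`, all primes outside `S`
  have hall : ∀ Φ ∈ (cuspInvariants M Kb).map (boundaryOf Kb),
      (∀ i ∈ (Set.univ : Set idx), Φ ∈ (Tb i).maxGenEigenspace (ι (lam i.1))) → Φ = 0 := by
    intro Φ hΦ heig
    refine boundaryEisenstein M S hS (fun ℓ => ι (lam ℓ)) Φ hΦ (fun r _ hr hrS => ?_) hne
    have := heig ⟨r, hr, hrS⟩ (Set.mem_univ _)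
    convert this
  -- finitely many primes suffice (finite-dimensional boundary module over `K̄`)
  haveI : FiniteDimensional Kb (cuspInvariants M Kb) := finiteDimensional_cuspInvariants M Kb
  haveI : FiniteDimensional Kb ((cuspInvariants M Kb).map (boundaryOf Kb)) := inferInstance
  obtain ⟨F, -, hF⟩ := exists_finset_forall_mem_imp_eq_zero ((cuspInvariants M Kb).map (boundaryOf Kb)) Tb
    (fun i => ι (lam i.1)) Set.univ hall
  refine ⟨F, fun Ψ hΨ heig => ?_⟩
  apply eq_zero_of_baseChange_eq_zero ι
  refine hF _ (mem_boundary_baseChange ι M hΨ) fun i hi => ?_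
  haveI : NeZero i.1 := ⟨i.2.1.ne_zero⟩
  exact mem_maxGenEigenspace_baseChange ι M (heig i hi)

end Finite

/-! ### §3  (BND) in the shape consumed by the assembly -/

section BND

variable {p t : ℕ}

/-- **(BND) PROVED** (for `t` prime): for `λ̄` non-Eisenstein and any exponents `k`, a word of Hecke polynomials `q_r(T_r)`,
`r ∉ S`, `r ∤ tⁿ`, `r ∤ L tⁿ`, `q_r ≡ 1 mod (X − λ(r))^{k r}`, indexed at level `L`, killing every boundary symbol of level
`L tⁿ` — the hypothesis `hBND` of `shiftInvariantIsDiamond_body_of_parabolic_of_boundaryKilled`, verbatim. [folklore] -/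
theorem boundaryKilled_of_prime (ht : t.Prime) (n : ℕ) :
    ∀ (K : Type) [Field K] [CharP K p] (L : ℕ) [NeZero L] (S : Finset ℕ) (lam : ℕ → K),
      (∀ q : ℕ, q.Prime → q ∣ p * t * L → q ∈ S) →
      ¬ IsEisensteinEigensystem 2 (fun ℓ => algebraMap K (AlgebraicClosure K) (lam ℓ)) →
      ∀ k : ℕ → ℕ, ∃ F : List ({r : ℕ // r.Prime} × K[X]),
        (∀ rq ∈ F, rq.1.1 ∉ S ∧ ¬ rq.1.1 ∣ t ^ n ∧ ¬ rq.1.1 ∣ L * t ^ n ∧ (X - C (lam rq.1.1)) ^ (k rq.1.1) ∣ rq.2 - 1) ∧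
        ∀ Ψ : OnePoint ℚ → OnePoint ℚ → K, (∀ a b c, Ψ a b + Ψ b c = Ψ a c) →
          (∀ γ : Gamma0 (L * t ^ n), ∀ a b, Ψ (mapGL ℚ (γ : SL(2, ℤ)) • a) (mapGL ℚ (γ : SL(2, ℤ)) • b) = Ψ a b) →
          (∀ γ : Gamma0 (L * t ^ n), Ψ OnePoint.infty (mapGL ℚ (γ : SL(2, ℤ)) • OnePoint.infty) = 0) →
          F.foldr (fun rq Ψ => aeval (@symbolHecke L rq.1.1 ⟨rq.1.2.ne_zero⟩ K _) rq.2 Ψ) Ψ = 0 := by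
  intro K _ _ L _ S lam hS hne k
  classical
  haveI : NeZero t := ⟨ht.ne_zero⟩
  set M : ℕ := L * t ^ n with hM
  haveI : NeZero M := ⟨mul_ne_zero (NeZero.ne L) (pow_ne_zero n ht.ne_zero)⟩
  -- primes outside `S` divide neither `L` nor `t` nor `M`
  have hSL : ∀ r : ℕ, r.Prime → r ∉ S → ¬ r ∣ L := fun r hr hrS hd =>
    hrS (hS r hr (dvd_mul_of_dvd_right hd _))
  have hSt : ∀ r : ℕ, r.Prime → r ∉ S → ¬ r ∣ t ^ n := fun r hr hrS hd =>
    hrS (hS r hr (dvd_mul_of_dvd_left (dvd_mul_of_dvd_right (hr.dvd_of_dvd_pow hd) _) _))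
  have hSM : ∀ r : ℕ, r.Prime → r ∉ S → ¬ r ∣ M := fun r hr hrS hd =>
    ((Nat.Prime.dvd_mul hr).1 hd).elim (hSL r hr hrS) (hSt r hr hrS)
  have hS' : ∀ q : ℕ, q.Prime → q ∣ M → q ∈ S := fun q hq hqM => by
    by_contra hqS; exact hSM q hq hqS hqM
  -- E-es-30 over `K` at a finite set of primes
  obtain ⟨F, hF⟩ := boundary_gen_eigen_eq_zero_finset M S hS' lam hne
  -- the annihilating word over `K`
  let idx := {r : ℕ // r.Prime ∧ r ∉ S}
  let B : Submodule K (OnePoint ℚ → OnePoint ℚ → K) := (cuspInvariants M K).map (boundaryOf K)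
  haveI : FiniteDimensional K (cuspInvariants M K) := finiteDimensional_cuspInvariants M K
  haveI : FiniteDimensional K B := inferInstance
  let T : idx → Module.End K (OnePoint ℚ → OnePoint ℚ → K) := fun i => @symbolHecke M i.1 ⟨i.2.1.ne_zero⟩ K _
  have hTB : ∀ i : idx, ∀ x ∈ B, T i x ∈ B := by
    intro i x hx
    haveI : NeZero i.1 := ⟨i.2.1.ne_zero⟩
    exact symbolHecke_mem M i.2.1 (hSM i.1 i.2.1 i.2.2) hx
  have hcomm : ∀ i j : idx, ∀ x ∈ B, T i (T j x) = T j (T i x) := by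
    intro i j x hx
    haveI : NeZero i.1 := ⟨i.2.1.ne_zero⟩
    haveI : NeZero j.1 := ⟨j.2.1.ne_zero⟩
    exact symbolHecke_comm_of_mem M j.2.1 i.2.1 (hSM j.1 j.2.1 j.2.2) (hSM i.1 i.2.1 i.2.2) hx
  obtain ⟨q, hq, hkill⟩ := exists_heckeWord_annihilating B T hTB hcomm (fun i => lam i.1) F
    (fun x hx hgen => hF x hx hgen) (fun i => k i.1)
  -- move the index level from `M` to `L`
  have hLM : ∀ i : idx, @symbolHecke L i.1 ⟨i.2.1.ne_zero⟩ K _ = T i := by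
    intro i
    haveI : NeZero i.1 := ⟨i.2.1.ne_zero⟩
    exact symbolHecke_eq_of_not_dvd K (hSL i.1 i.2.1 i.2.2) (hSM i.1 i.2.1 i.2.2)
  refine ⟨F.toList.map (fun i => (⟨i.1, i.2.1⟩, q i)), ?_, ?_⟩
  · intro rq hrq
    obtain ⟨i, hi, rfl⟩ := List.mem_map.mp hrq
    exact ⟨i.2.2, hSt i.1 i.2.1 i.2.2, hSM i.1 i.2.1 i.2.2, hq i (Finset.mem_toList.mp hi)⟩
  · intro Ψ hsym hinv hδ
    -- `Ψ` is a boundary symbol of level `M`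
    have hΨB : Ψ ∈ B := by
      obtain ⟨w, hw, hΨ⟩ := exists_boundary_of_delta_eq_zero M Ψ hsym hinv hδ
      refine Submodule.mem_map.mpr ⟨w, (mem_cuspInvariants M K w).mpr hw, ?_⟩
      funext a b
      rw [boundaryOf_apply, hΨ a b]
    rw [List.foldr_map]
    have e : (fun (i : idx) (Ψ : OnePoint ℚ → OnePoint ℚ → K) =>
        aeval (@symbolHecke L i.1 ⟨i.2.1.ne_zero⟩ K _) (q i) Ψ) = fun i y => aeval (T i) (q i) y := by
      funext i y
      rw [hLM i]
    rw [e]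
    exact hkill Ψ hΨB

end BND

/-! ### §4  The leaf from PARABOLICITY alone -/

/-- **E-es-25 `RelativeIharaShiftVanishingBar p t n` ⟸ PARABOLICITY** (the `∂`-twin of E-es-30: under the leaf's binders,
`λ̄` Eisenstein or `u` kills every cusp-fixing `γ ∈ Γ₀(L)`).  Everything else — E-es-29a lift (p2), the polynomial-projector
LIFT, E-es-30 (p2) + (BND), LEMMA G (p1), the Vaserstein bottom, HECKE-DIAMOND and the END (p3) — is a tree theorem.
[folklore] -/
theorem relativeIharaShiftVanishingBar_of_parabolic {p t n : ℕ}
    (hPAR : ∀ (K : Type) [Field K] [CharP K p] (L : ℕ) [NeZero L] (S : Finset ℕ) (lam : ℕ → K) (u : cocycles 0 L K),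
      (∀ q : ℕ, q.Prime → q ∣ p * t * L → q ∈ S) → IsHeckeGenEigenvector S lam u →
      IsEisensteinEigensystem 2 (fun ℓ => algebraMap K (AlgebraicClosure K) (lam ℓ)) ∨
        ∀ γ : Gamma0 L, ∀ c : OnePoint ℚ, mapGL ℚ (γ : SL(2, ℤ)) • c = c → (u : Gamma0 L → Fin 1 → K) γ 0 = 0) :
    RelativeIharaShiftVanishingBar p t n := by
  by_cases ht : t.Prime
  · exact relativeIharaShiftVanishingBar_of_parabolic_of_boundaryKilled hPAR (boundaryKilled_of_prime ht n)
  · intro _ ht' _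
    exact absurd ht' ht

end

end Summit.BirchSwinnertonDyer.BirchSwinnertonDyer.Theorems.ManinLocalTwoThree
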